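import Summits.BirchSwinnertonDyer.BirchSwinnertonDyer.Theorems.TwoAdicConverseOrdLambdaHalfAtTwoBDPTwoVariableDefs
import Summits.BirchSwinnertonDyer.BirchSwinnertonDyer.Theorems.TwoAdicConverseBDPSelmerLowerDivisibilityAtTwoGaussContent
import Summits.BirchSwinnertonDyer.BirchSwinnertonDyer.Theorems.TwoAdicConverseBDPSelmerLowerDivisibilityAtTwoCharIdealPrincipal
import HarnessLib

/-!
# Line `anticyclotomic_fibre_pinning_two` — a RESPLIT of the research stub `Rres` of the line of record
# `two_variable_gv_squeeze_two` (v3) for O2 `BDPSelmerLowerDivisibilityAtTwo` (stmt-BirchSwinnertonDyer-24728)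

Crux idea `anticyclotomic-fibre-pinning-two` (Cruxes/BDPSelmerLowerDivisibilityAtTwo/Ideas/anticyclotomic-fibre-pinning-two.md;
crux-ideate seat 1, round 1, GEN 3, 2026-08-30).  NOT a second registered skeleton (director RC-555: single skeleton slot =
`Lines/two_variable_gv_squeeze_two.lean`); this file is the TYPED NODE behind a RESPLIT PROPOSAL for the lead.

THE MOVE (special-fibre pinning at a PRIME of `𝔽̄₂⟦T₁,T₂⟧` instead of at its generic point).  The line of record closes
O2 from U (upper inclusion with `2`-power slack) and `Rres` = "`μ_alg = 0` and `(red G) = (red C)` in `𝔽̄₂⟦T₁,T₂⟧`"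
— a residual statement at the GENERIC point `𝔓 = ⊥` of the special fibre, whose analytic leaf R_an (a two-variable
measure-level CM congruence OFF the anticyclotomic line) is unprinted at every `p`.  The kernel lemma `PrimePinning₂`
below shows that the squeeze needs much less: for ANY prime `𝔓 ⊂ 𝔽̄₂⟦T₁,T₂⟧` with `red G ∉ 𝔓` (N: `μ = 0` ALONG `𝔓`)
and `red C₁ ∈ 𝔓 + (red G)` for the primitive part `C₁` of the algebraic generator (Λ: the `λ`-INEQUALITY along `𝔓`,
analytic `≤` algebraic), `2^m·G ∈ (C)` already forces `(C) ⊆ (G)`.  Taking `𝔓` = the residual ANTICYCLOTOMIC LINE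
(`T₁ = 0` in coordinates adapted to `(κ₁, κ_ac)`; `UnrSeries₂.minus`) puts both research leaves where CM congruences
(Kriz 2016 Thm. 3, every `χ ∈ Σ̂_cc`, hypothesis only `p ∤ N`) and Hida-type `μ = 0` theorems (Hida 2010 Thm. I, Hsieh 2014,
BCS 2025 Prop. 4.2.2 — all `p` odd, typed in the tree as `prop422_greenbergAnyRoot_hasUnitContent_minus` (v2, with the `Ω ≠ 0` binder — kept here too),
`thmI_mu_katzBranch_reflect_eq_zero`) live, and it DROPS the algebraic two-variable `μ = 0` of `Rres` altogether.
`𝔓 = ⊥` is the line of record (`fibrePinned_of_residualEquality`); `𝔓 = 𝔪` (the closed point) is the dead line PIN𝟙 of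
GEN 2 (N fails: `G(𝟙) ≡ 0` at `2 ∤ N`, Kriz–Li 2019); `𝔓` = cyclotomic line is the dead line CNE of GEN 0 (no congruence).

TYPED NODE: `O2 ⟸ P0 ∧ PIN ∧ CONTENT ∧ U ∧ R0T ∧ ACPIN` —
`bdpSelmerLowerDivisibilityAtTwo_of_acPieces` (sorry-free); P0 and PIN are KERNEL (proved: p766476, and §1 below);
CONTENT is kernel algebra (`2`-content of a nonzero element of `ℤ₂⟦T₁,T₂⟧`; proved in §2 below);
U and R0T are the line of record's research stubs, copied VERBATIM (same decl names) so the lead can identify them;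
ACPIN (`AcFibrePinningAtTwo`) is the NEW research stub replacing `Rres`.  Its anticyclotomic-coordinate shadows
N_ac (`AcMuZeroAtTwo`, currency `HasUnitContent (minus G)` = the tree's `μ(G⁻) = 0` token) and Λ_ac (`AcLambdaLowerAtTwo`)
imply its body on `(κ₁, κ_ac)`-adapted pairs (`fibrePinned_of_minus`).
HONESTY: nothing here is proved about any curve; BSD is proved for no curve; O2 stays open; typed ≠ proved.
-/

set_option linter.dupNamespace false
set_option autoImplicit false

noncomputable section

open scoped Classical NumberField
open WeierstrassCurve NumberField IsDedekindDomain Field CategoryTheory Function PowerSeries CongruenceSubgroup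
open Literature.NumberTheory.EllipticCurves Literature.NumberTheory.EllipticCurves.Rank1Residual
open Literature.NumberTheory.EllipticCurves.ModularForms
open Literature.NumberTheory.GaloisRepresentations
open Literature.NumberTheory.EllipticCurves.IwasawaAlgebra₂ Literature.NumberTheory.EllipticCurves.UnrSeries₂
open Literature.NumberTheory.EllipticCurves.YanZhu2026
open Literature.NumberTheory.EllipticCurves.GreenbergVatsal2000
open Summit.BirchSwinnertonDyer.BirchSwinnertonDyer.Theorems.TwoAdicKatoDeterminant
open Summit.BirchSwinnertonDyer.BirchSwinnertonDyer.Theorems.TwoAdicBDPGaussContent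

namespace Summit.BirchSwinnertonDyer.BirchSwinnertonDyer.Cruxes.BDPSelmerLowerDivisibilityAtTwo.AnticyclotomicFibrePinningTwo

/-- The coefficient ring of the analytic side at `2`: `𝒪_{ℂ₂}⟦T₁,T₂⟧` (verbatim the line of record's `A₂`). -/
abbrev A₂ : Type := PowerSeries (PowerSeries (PadicComplexInt 2))

/-- The coefficient field of the special fibre: `𝔽̄₂ = 𝒪_{ℂ₂}/𝔪`. -/
abbrev k₂ : Type := IsLocalRing.ResidueField (PadicComplexInt 2)

/-- The RESIDUAL Iwasawa algebra `𝔽̄₂⟦T₁,T₂⟧` (verbatim the line of record's `Ω₂`): a 2-dimensional regular LOCAL domain. -/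
abbrev Ω₂ : Type := PowerSeries (PowerSeries k₂)

/-- Coefficientwise reduction `𝒪_{ℂ₂}⟦T₁,T₂⟧ → 𝔽̄₂⟦T₁,T₂⟧` (verbatim the line of record's `red₂`). -/
def red₂ : A₂ →+* Ω₂ := PowerSeries.map (PowerSeries.map (IsLocalRing.residue (PadicComplexInt 2)))

/-! ## §1. KERNEL: pinning the cofactor at a prime of the special fibre (`PrimePinning₂`, proved) -/

/-- **FibrePinned G C'** — the residual pinning datum for an analytic generator `G` and (the image `C'` of) an algebraic
generator: SOME prime `𝔓` of `𝔽̄₂⟦T₁,T₂⟧` (intended: the residual anticyclotomic line in the coordinates of the adapted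
pair; `⊥` recovers the line of record's residual equality) with
(N) `red G ∉ 𝔓` — `G mod 𝔪` does not vanish identically along `𝔓` (`μ = 0` along the line), and
(Λ) for every PRIMITIVE part `C₁` of `C'` (`C' = 2^a·C₁`, `red C₁ ≠ 0`): `red C₁ ∈ 𝔓 + (red G)` — along `𝔓`, `red G`
divides `red C₁` (the `λ`-inequality "analytic ≤ algebraic" for the `μ`-free parts; vacuity-safe: stated for `C₁`, not `C'`). -/
def FibrePinned (G C' : A₂) : Prop :=
  ∃ 𝔓 : Ideal Ω₂, 𝔓.IsPrime ∧ red₂ G ∉ 𝔓 ∧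
    ∀ (a : ℕ) (C₁ : A₂), C' = (2 : A₂) ^ a * C₁ → red₂ C₁ ≠ 0 → red₂ C₁ ∈ 𝔓 ⊔ Ideal.span {red₂ G}

/-- **PIN — pinning at a prime of the special fibre** (pure commutative algebra over `𝒪_{ℂ₂}⟦T₁,T₂⟧`): if
`2^m·G = 2^a·C₁·h` with `red C₁ ≠ 0`, and for some prime `𝔓` of `𝔽̄₂⟦T₁,T₂⟧` one has `red G ∉ 𝔓` and
`red C₁ ∈ 𝔓 + (red G)`, then `(2^a·C₁) ⊆ (G)`.  Proof: `a ≤ m` (else `red G = 0 ∈ 𝔓`); Gauss content for constants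
gives `h = 2^{m-a}·h₀`, `G = C₁·h₀`; modulo `𝔪`: `Ḡ(1 - q·h̄₀) ∈ 𝔓`, so `1 - q·h̄₀ ∈ 𝔓 ⊆ 𝔪_Ω` and `h̄₀` is a unit of the
LOCAL ring `𝔽̄₂⟦T₁,T₂⟧`, hence `h₀` is a unit. -/
def PrimePinning₂ : Prop :=
  ∀ (C₁ G h : A₂) (a m : ℕ) (𝔓 : Ideal Ω₂), 𝔓.IsPrime →
    (2 : A₂) ^ m * G = (2 : A₂) ^ a * C₁ * h → red₂ C₁ ≠ 0 → red₂ G ∉ 𝔓 →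
    red₂ C₁ ∈ 𝔓 ⊔ Ideal.span {red₂ G} → Ideal.span {(2 : A₂) ^ a * C₁} ≤ Ideal.span {G}

/-- `2^a = C(C(2^a))` in `𝒪_{ℂ₂}⟦T₁,T₂⟧`. [folklore] -/
theorem two_pow_eq_C_C (a : ℕ) :
    (2 : A₂) ^ a = PowerSeries.C (PowerSeries.C ((2 : PadicComplexInt 2) ^ a)) := by
  simp only [map_pow, map_ofNat]

/-- `2 ≠ 0` in `𝒪_{ℂ₂}`. [folklore] -/
theorem two_ne_zero_padicComplexInt : (2 : PadicComplexInt 2) ≠ 0 := by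
  have h := natCast_prime_padicComplexInt_ne_zero (p := 2)
  rwa [Nat.cast_ofNat] at h

/-- `2^a ≠ 0` in `𝒪_{ℂ₂}⟦T₁,T₂⟧`. [folklore] -/
theorem two_pow_ne_zero_A₂ (a : ℕ) : (2 : A₂) ^ a ≠ 0 := by
  rw [two_pow_eq_C_C]
  exact C_C_ne_zero (pow_ne_zero a two_ne_zero_padicComplexInt)

/-- `(2 : 𝒪_{ℂ₂}) = 2` in `ℂ₂` (coercion of the numeral through the valuation subring). [folklore] -/
theorem coe_two_padicComplexInt : ((2 : PadicComplexInt 2) : ℂ_[2]) = 2 := by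
  rw [show (2 : PadicComplexInt 2) = 1 + 1 from one_add_one_eq_two.symm, AddMemClass.coe_add, OneMemClass.coe_one,
    one_add_one_eq_two]

/-- `‖2‖ = 2⁻¹` in `ℂ₂`. [folklore] -/
theorem norm_two_padicComplex : ‖(2 : ℂ_[2])‖ = (2 : ℝ)⁻¹ := by
  have h : ‖((2 : ℕ) : ℂ_[2])‖ = ((2 : ℕ) : ℝ)⁻¹ := by
    rw [← map_natCast (algebraMap ℚ_[2] ℂ_[2]) 2]
    exact (PadicComplex.norm_extends' (p := 2) ((2 : ℕ) : ℚ_[2])).trans Padic.norm_p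
  simpa only [Nat.cast_ofNat] using h

/-- `2 ∈ 𝔪_{𝒪_{ℂ₂}}`: the residue of `2` vanishes. [folklore] -/
theorem residue_two_eq_zero : IsLocalRing.residue (PadicComplexInt 2) 2 = 0 := by
  rw [IsLocalRing.residue_eq_zero_iff, IsLocalRing.mem_maximalIdeal, mem_nonunits_iff,
    isUnit_padicComplexInt_iff, coe_two_padicComplexInt, norm_two_padicComplex]
  norm_num

/-- `red₂ 2 = 0`: the special fibre has characteristic `2`. [folklore] -/
theorem red₂_two : red₂ (2 : A₂) = 0 := by
  have h : red₂ (2 : A₂) = PowerSeries.C (PowerSeries.C (IsLocalRing.residue (PadicComplexInt 2) 2)) := by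
    rw [show (2 : A₂) = PowerSeries.C (PowerSeries.C (2 : PadicComplexInt 2)) by simp only [map_ofNat], red₂,
      PowerSeries.map_C, PowerSeries.map_C]
  rw [h, residue_two_eq_zero, map_zero, map_zero]

/-- **PIN holds** (kernel; the seam of this node). [folklore] -/
theorem primePinning₂_holds : PrimePinning₂ := by
  intro C₁ G h a m 𝔓 h𝔓 hGCh hC₁ hN hΛ
  rcases Nat.lt_or_ge m a with hma | ham
  · -- `m < a`: then `G = 2·(…)`, so `red G = 0 ∈ 𝔓`, contradicting (N)
    obtain ⟨n, rfl⟩ : ∃ n, a = m + (n + 1) := ⟨a - m - 1, by omega⟩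
    have h1 : G = (2 : A₂) ^ (n + 1) * C₁ * h := by
      refine mul_left_cancel₀ (two_pow_ne_zero_A₂ m) ?_
      rw [hGCh, pow_add]; ring
    have h0 : red₂ G = 0 := by
      rw [h1, map_mul, map_mul, map_pow, red₂_two, zero_pow (Nat.succ_ne_zero n), zero_mul, zero_mul]
    exact absurd (show red₂ G ∈ 𝔓 by rw [h0]; exact 𝔓.zero_mem) hN
  · -- `a ≤ m`: cancel `2^a`, then Gauss content for the constant `2^(m-a)`
    obtain ⟨n, rfl⟩ := Nat.exists_eq_add_of_le ham
    have h1 : (2 : A₂) ^ n * G = C₁ * h := by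
      refine mul_left_cancel₀ (two_pow_ne_zero_A₂ a) ?_
      rw [← mul_assoc, ← pow_add, hGCh, mul_assoc]
    have hC₁u : ∃ i : ℕ × ℕ, IsUnit (coeff i.2 (coeff i.1 C₁)) :=
      exists_isUnit_coeff_of_map_map_residue_ne_zero hC₁
    have hdvd : PowerSeries.C (PowerSeries.C ((2 : PadicComplexInt 2) ^ n)) ∣ C₁ * h :=
      ⟨G, by rw [← h1, two_pow_eq_C_C]⟩
    obtain ⟨h₀, rfl⟩ := C_C_dvd_of_C_C_dvd_mul_of_exists_isUnit_coeff hC₁u hdvd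
    have hG : G = C₁ * h₀ := by
      refine mul_left_cancel₀ (two_pow_ne_zero_A₂ n) ?_
      rw [h1, two_pow_eq_C_C]; ring
    -- residual bookkeeping in the LOCAL ring `𝔽̄₂⟦T₁,T₂⟧`
    obtain ⟨t, ht, s, hs, hts⟩ := Submodule.mem_sup.mp hΛ
    obtain ⟨q, rfl⟩ := Ideal.mem_span_singleton'.mp hs
    have hGred : red₂ G = red₂ C₁ * red₂ h₀ := by rw [hG, map_mul]
    have hkey : red₂ G * (1 - q * red₂ h₀) = t * red₂ h₀ := by
      have e : red₂ G = (t + q * red₂ G) * red₂ h₀ := by rw [hts]; exact hGred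
      linear_combination e
    have hmem : red₂ G * (1 - q * red₂ h₀) ∈ 𝔓 := by
      rw [hkey]; exact 𝔓.mul_mem_right _ ht
    rcases h𝔓.mem_or_mem hmem with h0 | h0
    · exact absurd h0 hN
    · have hmax : 1 - q * red₂ h₀ ∈ IsLocalRing.maximalIdeal Ω₂ := IsLocalRing.le_maximalIdeal h𝔓.ne_top h0
      have hunit : IsUnit (q * red₂ h₀) := by
        rcases IsLocalRing.isUnit_or_isUnit_one_sub_self (q * red₂ h₀) with hu | hu
        · exact hu
        · exact absurd hu (mem_nonunits_iff.mp ((IsLocalRing.mem_maximalIdeal _).mp hmax))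
      obtain ⟨u, hu⟩ := isUnit_of_isUnit_map_map_residue (isUnit_of_mul_isUnit_right hunit)
      refine Ideal.span_singleton_le_span_singleton.mpr ⟨↑u⁻¹ * (2 : A₂) ^ a, ?_⟩
      rw [hG, ← hu, mul_assoc, Units.mul_inv_cancel_left, mul_comm]

/-- **The line of record is the generic point `𝔓 = ⊥`**: its residual equality (`red C' ≠ 0` and `(red G) = (red C')`)
implies `FibrePinned G C'` — so the new research stub ACPIN is WEAKER than (implied by) `Rres`. [folklore] -/
theorem fibrePinned_of_residualEquality (G C' : A₂) (hC' : red₂ C' ≠ 0)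
    (hGC : Ideal.span {red₂ G} = Ideal.span {red₂ C'}) : FibrePinned G C' := by
  refine ⟨⊥, Ideal.isPrime_bot, ?_, fun a C₁ haC₁ hC₁ => ?_⟩
  · intro hG0
    have hG0' : red₂ G = 0 := by simpa using hG0
    have hmem : red₂ C' ∈ Ideal.span {red₂ G} := hGC ▸ Ideal.mem_span_singleton_self _
    rw [hG0', Ideal.span_singleton_eq_bot.mpr rfl, Ideal.mem_bot] at hmem
    exact hC' hmem
  · rw [bot_sup_eq, hGC]
    rcases Nat.eq_zero_or_pos a with rfl | ha
    · rw [pow_zero, one_mul] at haC₁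
      rw [← haC₁]; exact Ideal.mem_span_singleton_self _
    · exfalso
      apply hC'
      rw [haC₁, map_mul, map_pow, red₂_two, zero_pow ha.ne', zero_mul]

/-- **The anticyclotomic coordinate line `T₁ = 0`** (`UnrSeries₂.minus`; the `κ₂`-line, anticyclotomic when `κ₂` is):
`μ(G⁻) = 0` (`HasUnitContent (minus G)`, the tree's token) and the divisibility `Ḡ⁻ ∣ C̄₁⁻` in `𝔽̄₂⟦T₂⟧` for every
primitive part give `FibrePinned G C'` with `𝔓 = (T₁) = ker (T₁ ↦ 0)`. [folklore] -/
theorem fibrePinned_of_minus (G C' : A₂) (hN : HasUnitContent (minus G))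
    (hΛ : ∀ (a : ℕ) (C₁ : A₂), C' = (2 : A₂) ^ a * C₁ → red₂ C₁ ≠ 0 →
      PowerSeries.map (IsLocalRing.residue (PadicComplexInt 2)) (minus G) ∣
        PowerSeries.map (IsLocalRing.residue (PadicComplexInt 2)) (minus C₁)) :
    FibrePinned G C' := by
  -- the restriction to `T₁ = 0` on the special fibre and its compatibility with `red₂`
  let π : Ω₂ →+* PowerSeries k₂ := PowerSeries.constantCoeff
  have hπ : ∀ X : A₂, π (red₂ X) = PowerSeries.map (IsLocalRing.residue (PadicComplexInt 2)) (minus X) := by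
    intro X
    show PowerSeries.constantCoeff (PowerSeries.map _ X) = _
    rw [← PowerSeries.coeff_zero_eq_constantCoeff_apply, PowerSeries.coeff_map, PowerSeries.coeff_zero_eq_constantCoeff_apply]
    rfl
  have hπC : ∀ q : PowerSeries k₂, π (PowerSeries.C q) = q := fun q => PowerSeries.constantCoeff_C q
  refine ⟨RingHom.ker π, RingHom.ker_isPrime π, ?_, fun a C₁ haC₁ hC₁ => ?_⟩
  · rw [RingHom.mem_ker, hπ]
    exact (hasUnitContent_iff_map_residue_ne_zero (minus G)).mp hN
  · obtain ⟨q, hq⟩ := hΛ a C₁ haC₁ hC₁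
    rw [← hπ, ← hπ] at hq
    refine Submodule.mem_sup.mpr ⟨red₂ C₁ - PowerSeries.C q * red₂ G, ?_, PowerSeries.C q * red₂ G,
      Ideal.mem_span_singleton'.mpr ⟨PowerSeries.C q, rfl⟩, sub_add_cancel _ _⟩
    rw [RingHom.mem_ker, map_sub, map_mul, hq, hπC]
    ring

/-! ## §2. KERNEL: the `2`-content of a nonzero element of `Λ_K = ℤ₂⟦T₁,T₂⟧` (`TwoContent₂`, proved) -/

/-- **CONTENT** — every nonzero `C₀ ∈ ℤ₂⟦T₁,T₂⟧` reads in `𝒪_{ℂ₂}⟦T₁,T₂⟧` as `2^a·C₁` with `C₁` PRIMITIVE (`red C₁ ≠ 0`),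
`a = μ(C₀)`.  (Discrete valuation on the coefficients; FALSE for a general element of `𝒪_{ℂ₂}⟦T₁,T₂⟧`, e.g. `Σ 2^{1/i}T₂^i`.) -/
def TwoContent₂ : Prop :=
  ∀ (J : ℤ_[2] →+* PadicComplexInt 2) (C₀ : IwasawaAlgebra₂ 2), C₀ ≠ 0 →
    ∃ (a : ℕ) (C₁ : A₂), toUnr₂ 2 J C₀ = (2 : A₂) ^ a * C₁ ∧ red₂ C₁ ≠ 0

/-- **CONTENT holds** (kernel). [folklore] -/
theorem twoContent₂_holds : TwoContent₂ := by
  intro J C₀ hC₀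
  -- a nonzero coefficient and its exact `2`-power
  have hcoef : ∃ ij : ℕ × ℕ, coeff ij.2 (coeff ij.1 C₀) ≠ 0 := by
    by_contra hall
    push Not at hall
    exact hC₀ (PowerSeries.ext fun i => PowerSeries.ext fun j => by simpa using hall (i, j))
  obtain ⟨ij₀, hij₀⟩ := hcoef
  have hirr : Irreducible (2 : ℤ_[2]) := by
    have h := PadicInt.irreducible_p (p := 2)
    rwa [Nat.cast_ofNat] at h
  obtain ⟨n₀, c, hc, hn₀⟩ := WfDvdMonoid.max_power_factor hij₀ hirr
  have hex : ∃ n : ℕ, ∃ ij : ℕ × ℕ, ¬ ((2 : ℤ_[2]) ^ (n + 1) ∣ coeff ij.2 (coeff ij.1 C₀)) := by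
    refine ⟨n₀, ij₀, fun hd => hc ?_⟩
    rw [hn₀, pow_succ] at hd
    exact (mul_dvd_mul_iff_left (pow_ne_zero n₀ hirr.ne_zero)).mp hd
  -- `a` := the least `n` such that some coefficient is not divisible by `2^(n+1)` (= `μ(C₀)`)
  obtain ⟨a, ha_spec, ha_min⟩ : ∃ a : ℕ, (∃ ij : ℕ × ℕ, ¬ ((2 : ℤ_[2]) ^ (a + 1) ∣ coeff ij.2 (coeff ij.1 C₀))) ∧
      ∀ n < a, ∀ ij : ℕ × ℕ, (2 : ℤ_[2]) ^ (n + 1) ∣ coeff ij.2 (coeff ij.1 C₀) := by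
    refine ⟨Nat.find hex, Nat.find_spec hex, fun n hn ij => ?_⟩
    have hmin := Nat.find_min hex hn
    push Not at hmin
    exact hmin ij
  have hdiv : ∀ ij : ℕ × ℕ, ∃ d : ℤ_[2], coeff ij.2 (coeff ij.1 C₀) = (2 : ℤ_[2]) ^ a * d := by
    intro ij
    rcases Nat.eq_zero_or_pos a with ha | ha
    · exact ⟨coeff ij.2 (coeff ij.1 C₀), by rw [ha, pow_zero, one_mul]⟩
    · obtain ⟨n, rfl⟩ : ∃ n, a = n + 1 := ⟨a - 1, by omega⟩
      exact ha_min n (Nat.lt_succ_self n) ij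
  choose d hd using hdiv
  refine ⟨a, PowerSeries.mk fun i => PowerSeries.mk fun j => J (d (i, j)), ?_, ?_⟩
  · -- `J(C₀) = 2^a · C₁` coefficientwise
    refine PowerSeries.ext fun i => PowerSeries.ext fun j => ?_
    rw [coeff_coeff_toUnr₂, hd (i, j), map_mul, map_pow, map_ofNat, two_pow_eq_C_C, PowerSeries.coeff_C_mul,
      PowerSeries.coeff_C_mul, PowerSeries.coeff_mk, PowerSeries.coeff_mk]
  · -- `C₁` is primitive: at the index realising `a`, `d` is a `2`-adic unit
    obtain ⟨ij₁, hij₁⟩ := ha_spec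
    have hd₁ : ¬ ((2 : ℤ_[2]) ∣ d ij₁) := by
      intro h2d
      apply hij₁
      rw [hd ij₁, pow_succ]
      exact mul_dvd_mul_left _ h2d
    have hunit : IsUnit (d ij₁) := by
      by_contra hnu
      apply hd₁
      have hmem : d ij₁ ∈ IsLocalRing.maximalIdeal ℤ_[2] :=
        (IsLocalRing.mem_maximalIdeal _).mpr (mem_nonunits_iff.mpr hnu)
      rw [PadicInt.maximalIdeal_eq_span_p, Ideal.mem_span_singleton] at hmem
      rwa [Nat.cast_ofNat] at hmem
    intro h0
    have hc := congrArg (fun F : Ω₂ => coeff ij₁.2 (coeff ij₁.1 F)) h0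
    simp only [red₂, PowerSeries.coeff_map, PowerSeries.coeff_mk, map_zero, Prod.mk.eta] at hc
    exact (IsLocalRing.residue_ne_zero_iff_isUnit _).mpr (hunit.map J) hc

/-! ## §3. The pieces at a datum `(W, K)` — binder for binder the frame of `GreenbergLowerInclusionAt W K`

`GreenbergUpperInclusionRatAt` (U), `GreenbergFrameTorsionAt` (R0T), `XGr₂CharIdealPrincipalAt` (P0) and
`GreenbergResidualEqualityForallAt` (Rres) are copied VERBATIM (names and bodies) from the line of record
`Lines/two_variable_gv_squeeze_two.lean` v3 @528d2d79580d (that module is not built on the farm, so it cannot be imported);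
`Iff.rfl` identifies them.  NEW: `GreenbergAcFibrePinningAt` (ACPIN) and its anticyclotomic-coordinate shadows. -/

/-- **U at `(E,K)`** (verbatim from the line of record) — the Euler-system-directional (UPPER) inclusion at `2` with
`2`-power slack, for EVERY admissible frame datum: `ch_{Λ_K}(X_Gr(E/K̃_∞))·𝒪_{ℂ₂}⟦T₁,T₂⟧ ∣ 2^m · G`. -/
def GreenbergUpperInclusionRatAt (W : WeierstrassCurve ℚ) [W.IsElliptic] [W.IsGloballyMinimal]
    (K : Type) [Field K] [NumberField K] : Prop :=
  ∀ [IsCMField K] (ι : PadicAlgCl 2 ≃+* ℂ) (v vbar : HeightOneSpectrum (𝓞 K)) (κ₁ κ₂ : ZpExtension K 2)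
    (γ₁ γ₂ : absoluteGaloisGroup K) [Fact (ZpExtension.IsTopGeneratorPair κ₁ κ₂ γ₁ γ₂)]
    [NeZero (W.conductorNorm ℤ)] (f : CuspForm (Gamma0 (W.conductorNorm ℤ)) 2),
    ModularForms.IsNewformOf W f → ∀ [NeZero (NumberField.discr K).natAbs],
    ((2 : ℕ) : 𝓞 K) ∈ v.asIdeal → ((2 : ℕ) : 𝓞 K) ∈ vbar.asIdeal → vbar ≠ v →
    (∀ (w : InfinitePlace K) (k : 𝓞 K), k ∈ v.asIdeal ↔ ‖ι.symm (w.embedding (k : K))‖ < 1) →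
    ∀ (Ω δ : ℂ) (Ωp : (unrIntegers 2)ˣ) (LK G : A₂),
      Ω ≠ 0 → (δ ^ 2 = (NumberField.discr K : ℂ) ∨ δ ^ 2 = -(NumberField.discr K : ℂ)) →
      IsKatzMeasure₂ ι v vbar ∅ κ₁ κ₂ γ₁⁻¹ γ₂⁻¹ 1 Ω δ ((Ωp : unrIntegers 2) : ℂ_[2]) LK →
      IsGreenbergLFunctionFree₂ ι v vbar κ₁ κ₂ γ₁⁻¹ γ₂⁻¹ f (NumberField.discr K).natAbs
        (NumberField.classNumber K) LK G →
      ∀ J : ℤ_[2] →+* PadicComplexInt 2,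
        (∀ x : ℤ_[2], ((J x : PadicComplexInt 2) : ℂ_[2]) = ((x : ℚ_[2]) : ℂ_[2])) →
        ∃ m : ℕ, Ideal.span {(2 : A₂) ^ m * G} ≤
          (WeierstrassCurve.XGr₂.charIdeal (W.baseChange K) 2 κ₁ κ₂ vbar γ₁ γ₂).map (toUnr₂ 2 J)

/-- **R0T at `(E,K)`** (verbatim from the line of record) — OBJECT half: an admissible frame datum exists at `2` and
`X_Gr(E/K̃_∞)` is `Λ_K`-torsion. -/
def GreenbergFrameTorsionAt (W : WeierstrassCurve ℚ) [W.IsElliptic] [W.IsGloballyMinimal]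
    (K : Type) [Field K] [NumberField K] : Prop :=
  ∀ [IsCMField K] (ι : PadicAlgCl 2 ≃+* ℂ) (v vbar : HeightOneSpectrum (𝓞 K)) (κ₁ κ₂ : ZpExtension K 2)
    (γ₁ γ₂ : absoluteGaloisGroup K) [Fact (ZpExtension.IsTopGeneratorPair κ₁ κ₂ γ₁ γ₂)]
    [NeZero (W.conductorNorm ℤ)] (f : CuspForm (Gamma0 (W.conductorNorm ℤ)) 2),
    ModularForms.IsNewformOf W f → ∀ [NeZero (NumberField.discr K).natAbs],
    ((2 : ℕ) : 𝓞 K) ∈ v.asIdeal → ((2 : ℕ) : 𝓞 K) ∈ vbar.asIdeal → vbar ≠ v →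
    (∀ (w : InfinitePlace K) (k : 𝓞 K), k ∈ v.asIdeal ↔ ‖ι.symm (w.embedding (k : K))‖ < 1) →
    ∃ (Ω δ : ℂ) (Ωp : (unrIntegers 2)ˣ) (LK G : A₂),
      Ω ≠ 0 ∧ (δ ^ 2 = (NumberField.discr K : ℂ) ∨ δ ^ 2 = -(NumberField.discr K : ℂ)) ∧
      IsKatzMeasure₂ ι v vbar ∅ κ₁ κ₂ γ₁⁻¹ γ₂⁻¹ 1 Ω δ ((Ωp : unrIntegers 2) : ℂ_[2]) LK ∧
      IsGreenbergLFunctionFree₂ ι v vbar κ₁ κ₂ γ₁⁻¹ γ₂⁻¹ f (NumberField.discr K).natAbs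
        (NumberField.classNumber K) LK G ∧
      Module.IsTorsion (IwasawaAlgebra₂ 2) ((W.baseChange K).XGr₂ 2 κ₁ κ₂ vbar γ₁ γ₂)

/-- **P0 at `(E,K)`** (verbatim from the line of record) — principality of the two-variable characteristic ideal. -/
def XGr₂CharIdealPrincipalAt (W : WeierstrassCurve ℚ) [W.IsElliptic] [W.IsGloballyMinimal]
    (K : Type) [Field K] [NumberField K] : Prop :=
  ∀ (vbar : HeightOneSpectrum (𝓞 K)) (κ₁ κ₂ : ZpExtension K 2) (γ₁ γ₂ : absoluteGaloisGroup K)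
    [Fact (ZpExtension.IsTopGeneratorPair κ₁ κ₂ γ₁ γ₂)],
    Module.IsTorsion (IwasawaAlgebra₂ 2) ((W.baseChange K).XGr₂ 2 κ₁ κ₂ vbar γ₁ γ₂) →
    ∃ C : IwasawaAlgebra₂ 2, WeierstrassCurve.XGr₂.charIdeal (W.baseChange K) 2 κ₁ κ₂ vbar γ₁ γ₂ = Ideal.span {C}

/-- **Rres at `(E,K)`** (verbatim from the line of record; used ONLY in the comparison annex §7) — the residual two-variable
equality at the generic point: `μ(C) = 0` and `(red G) = (red C)` in `𝔽̄₂⟦T₁,T₂⟧`, for every admissible frame datum. -/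
def GreenbergResidualEqualityForallAt (W : WeierstrassCurve ℚ) [W.IsElliptic] [W.IsGloballyMinimal]
    (K : Type) [Field K] [NumberField K] : Prop :=
  ∀ [IsCMField K] (ι : PadicAlgCl 2 ≃+* ℂ) (v vbar : HeightOneSpectrum (𝓞 K)) (κ₁ κ₂ : ZpExtension K 2)
    (γ₁ γ₂ : absoluteGaloisGroup K) [Fact (ZpExtension.IsTopGeneratorPair κ₁ κ₂ γ₁ γ₂)]
    [NeZero (W.conductorNorm ℤ)] (f : CuspForm (Gamma0 (W.conductorNorm ℤ)) 2),
    ModularForms.IsNewformOf W f → ∀ [NeZero (NumberField.discr K).natAbs],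
    ((2 : ℕ) : 𝓞 K) ∈ v.asIdeal → ((2 : ℕ) : 𝓞 K) ∈ vbar.asIdeal → vbar ≠ v →
    (∀ (w : InfinitePlace K) (k : 𝓞 K), k ∈ v.asIdeal ↔ ‖ι.symm (w.embedding (k : K))‖ < 1) →
    ∀ (Ω δ : ℂ) (Ωp : (unrIntegers 2)ˣ) (LK G : A₂),
      Ω ≠ 0 → (δ ^ 2 = (NumberField.discr K : ℂ) ∨ δ ^ 2 = -(NumberField.discr K : ℂ)) →
      IsKatzMeasure₂ ι v vbar ∅ κ₁ κ₂ γ₁⁻¹ γ₂⁻¹ 1 Ω δ ((Ωp : unrIntegers 2) : ℂ_[2]) LK →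
      IsGreenbergLFunctionFree₂ ι v vbar κ₁ κ₂ γ₁⁻¹ γ₂⁻¹ f (NumberField.discr K).natAbs
        (NumberField.classNumber K) LK G →
      ∀ J : ℤ_[2] →+* PadicComplexInt 2,
        (∀ x : ℤ_[2], ((J x : PadicComplexInt 2) : ℂ_[2]) = ((x : ℚ_[2]) : ℂ_[2])) →
        ∀ C : IwasawaAlgebra₂ 2,
          WeierstrassCurve.XGr₂.charIdeal (W.baseChange K) 2 κ₁ κ₂ vbar γ₁ γ₂ = Ideal.span {C} →
          red₂ (toUnr₂ 2 J C) ≠ 0 ∧ Ideal.span {red₂ G} = Ideal.span {red₂ (toUnr₂ 2 J C)}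

/-- **ACPIN at `(E,K)`** (NEW; the research stub replacing Rres) — for every admissible frame datum, every structure map `J`
and every generator `C₀` of `ch_{Λ_K}(X_Gr(E/K̃_∞))`: `FibrePinned G (J C₀)` — some prime `𝔓` of the special fibre
(INTENDED: the residual anticyclotomic line in the pair's coordinates; `(T₁)` for a `(κ₁, κ_ac)`-adapted pair) carries
(N) `μ(G|_𝔓) = 0` and (Λ) `λ(G|_𝔓) ≤ λ(C₁|_𝔓)` for the primitive part `C₁` of `J C₀`.  No algebraic `μ = 0`, no two-variable
ideal equality.  Content in prose = N_ac ∧ Λ_ac of the line card (Hida/Hsieh/BCS-type `μ = 0` on the anticyclotomic line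
at `2`; Kriz 2016 Thm. 3 CM congruence at `2` + GL(1) main conjecture for `K` at `2` + Greenberg–Vatsal-at-2 bookkeeping). -/
def GreenbergAcFibrePinningAt (W : WeierstrassCurve ℚ) [W.IsElliptic] [W.IsGloballyMinimal]
    (K : Type) [Field K] [NumberField K] : Prop :=
  ∀ [IsCMField K] (ι : PadicAlgCl 2 ≃+* ℂ) (v vbar : HeightOneSpectrum (𝓞 K)) (κ₁ κ₂ : ZpExtension K 2)
    (γ₁ γ₂ : absoluteGaloisGroup K) [Fact (ZpExtension.IsTopGeneratorPair κ₁ κ₂ γ₁ γ₂)]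
    [NeZero (W.conductorNorm ℤ)] (f : CuspForm (Gamma0 (W.conductorNorm ℤ)) 2),
    ModularForms.IsNewformOf W f → ∀ [NeZero (NumberField.discr K).natAbs],
    ((2 : ℕ) : 𝓞 K) ∈ v.asIdeal → ((2 : ℕ) : 𝓞 K) ∈ vbar.asIdeal → vbar ≠ v →
    (∀ (w : InfinitePlace K) (k : 𝓞 K), k ∈ v.asIdeal ↔ ‖ι.symm (w.embedding (k : K))‖ < 1) →
    ∀ (Ω δ : ℂ) (Ωp : (unrIntegers 2)ˣ) (LK G : A₂),
      Ω ≠ 0 → (δ ^ 2 = (NumberField.discr K : ℂ) ∨ δ ^ 2 = -(NumberField.discr K : ℂ)) →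
      IsKatzMeasure₂ ι v vbar ∅ κ₁ κ₂ γ₁⁻¹ γ₂⁻¹ 1 Ω δ ((Ωp : unrIntegers 2) : ℂ_[2]) LK →
      IsGreenbergLFunctionFree₂ ι v vbar κ₁ κ₂ γ₁⁻¹ γ₂⁻¹ f (NumberField.discr K).natAbs
        (NumberField.classNumber K) LK G →
      ∀ J : ℤ_[2] →+* PadicComplexInt 2,
        (∀ x : ℤ_[2], ((J x : PadicComplexInt 2) : ℂ_[2]) = ((x : ℚ_[2]) : ℂ_[2])) →
        ∀ C₀ : IwasawaAlgebra₂ 2,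
          WeierstrassCurve.XGr₂.charIdeal (W.baseChange K) 2 κ₁ κ₂ vbar γ₁ γ₂ = Ideal.span {C₀} →
          FibrePinned G (toUnr₂ 2 J C₀)

/-- **ACPIN on anticyclotomic-adapted pairs at `(E,K)`** — the same, restricted to adapted pairs `(κ₁, κ₂)` whose second
member `κ₂` IS the anticyclotomic `ℤ₂`-extension (such pairs exist at `2`; only `(κ_cyc, κ_ac)` does not — index two).
`GreenbergAcFibrePinningAt → GreenbergAcFibrePinningOnAcPairsAt` trivially; the converse is the (untyped) covariance of the
frames under a change of adapted pair. -/
def GreenbergAcFibrePinningOnAcPairsAt (W : WeierstrassCurve ℚ) [W.IsElliptic] [W.IsGloballyMinimal]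
    (K : Type) [Field K] [NumberField K] : Prop :=
  ∀ [IsCMField K] (ι : PadicAlgCl 2 ≃+* ℂ) (v vbar : HeightOneSpectrum (𝓞 K)) (κ₁ κ₂ : ZpExtension K 2)
    (γ₁ γ₂ : absoluteGaloisGroup K) [Fact (ZpExtension.IsTopGeneratorPair κ₁ κ₂ γ₁ γ₂)]
    [NeZero (W.conductorNorm ℤ)] (f : CuspForm (Gamma0 (W.conductorNorm ℤ)) 2),
    ModularForms.IsNewformOf W f → ∀ [NeZero (NumberField.discr K).natAbs],
    ((2 : ℕ) : 𝓞 K) ∈ v.asIdeal → ((2 : ℕ) : 𝓞 K) ∈ vbar.asIdeal → vbar ≠ v →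
    (∀ (w : InfinitePlace K) (k : 𝓞 K), k ∈ v.asIdeal ↔ ‖ι.symm (w.embedding (k : K))‖ < 1) →
    κ₂.IsAnticyclotomic →
    ∀ (Ω δ : ℂ) (Ωp : (unrIntegers 2)ˣ) (LK G : A₂),
      Ω ≠ 0 → (δ ^ 2 = (NumberField.discr K : ℂ) ∨ δ ^ 2 = -(NumberField.discr K : ℂ)) →
      IsKatzMeasure₂ ι v vbar ∅ κ₁ κ₂ γ₁⁻¹ γ₂⁻¹ 1 Ω δ ((Ωp : unrIntegers 2) : ℂ_[2]) LK →
      IsGreenbergLFunctionFree₂ ι v vbar κ₁ κ₂ γ₁⁻¹ γ₂⁻¹ f (NumberField.discr K).natAbs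
        (NumberField.classNumber K) LK G →
      ∀ J : ℤ_[2] →+* PadicComplexInt 2,
        (∀ x : ℤ_[2], ((J x : PadicComplexInt 2) : ℂ_[2]) = ((x : ℚ_[2]) : ℂ_[2])) →
        ∀ C₀ : IwasawaAlgebra₂ 2,
          WeierstrassCurve.XGr₂.charIdeal (W.baseChange K) 2 κ₁ κ₂ vbar γ₁ γ₂ = Ideal.span {C₀} →
          FibrePinned G (toUnr₂ 2 J C₀)

/-- **N_ac at `(E,K)`** — `μ = 0` for the two-variable `L`-function ALONG THE ANTICYCLOTOMIC LINE at `2`, in the tree's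
token `HasUnitContent (minus G)` (some coefficient `[T₁⁰T₂ʲ] G` is a unit of `𝒪_{ℂ₂}`), on `(κ₁, κ_ac)`-adapted pairs and
O2's frame `IsGreenbergLFunctionFree₂`.  The `p`-odd sibling is the tree's NAMED FACT
`BurungaleCastellaSkinner2025.prop422_greenbergAnyRoot_hasUnitContent_minus` (BCS 2025 Prop. 4.2.2 ⟸ Hsieh 2014 Thm. B + CGS23 Prop. 1.4.5; v2 = WITH the `Ω ≠ 0`, `δ² = ±D_K` binders, as here;
there under (irr_K), which FAILS on habitat (β)) and Hida 2010 Thm. I (`Hida2010MuInvariant.thmI_mu_katzBranch_reflect_eq_zero`,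
`2 < p`).  UNPRINTED at `p = 2`; INSTRUMENTABLE (2-adic valuations of normalised `L(f_E, χ, 1)`, `χ` anticyclotomic of
`2`-power conductor). -/
def GreenbergAcMuZeroAt (W : WeierstrassCurve ℚ) [W.IsElliptic] [W.IsGloballyMinimal]
    (K : Type) [Field K] [NumberField K] : Prop :=
  ∀ [IsCMField K] (ι : PadicAlgCl 2 ≃+* ℂ) (v vbar : HeightOneSpectrum (𝓞 K)) (κ₁ κ₂ : ZpExtension K 2)
    (γ₁ γ₂ : absoluteGaloisGroup K) [Fact (ZpExtension.IsTopGeneratorPair κ₁ κ₂ γ₁ γ₂)]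
    [NeZero (W.conductorNorm ℤ)] (f : CuspForm (Gamma0 (W.conductorNorm ℤ)) 2),
    ModularForms.IsNewformOf W f → ∀ [NeZero (NumberField.discr K).natAbs],
    ((2 : ℕ) : 𝓞 K) ∈ v.asIdeal → ((2 : ℕ) : 𝓞 K) ∈ vbar.asIdeal → vbar ≠ v →
    (∀ (w : InfinitePlace K) (k : 𝓞 K), k ∈ v.asIdeal ↔ ‖ι.symm (w.embedding (k : K))‖ < 1) →
    κ₂.IsAnticyclotomic →
    ∀ (Ω δ : ℂ) (Ωp : (unrIntegers 2)ˣ) (LK G : A₂),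
      Ω ≠ 0 → (δ ^ 2 = (NumberField.discr K : ℂ) ∨ δ ^ 2 = -(NumberField.discr K : ℂ)) →
      IsKatzMeasure₂ ι v vbar ∅ κ₁ κ₂ γ₁⁻¹ γ₂⁻¹ 1 Ω δ ((Ωp : unrIntegers 2) : ℂ_[2]) LK →
      IsGreenbergLFunctionFree₂ ι v vbar κ₁ κ₂ γ₁⁻¹ γ₂⁻¹ f (NumberField.discr K).natAbs
        (NumberField.classNumber K) LK G →
      HasUnitContent (minus G)

/-- **Λ_ac at `(E,K)`** — the `λ`-INEQUALITY along the anticyclotomic line at `2` ("analytic `≤` algebraic" for the `μ`-free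
parts): on `(κ₁, κ_ac)`-adapted pairs, for every structure map `J`, generator `C₀` of `ch(X_Gr)` and primitive part `C₁` of
`J C₀`, the reduction of `G⁻ = G(0,T₂)` DIVIDES the reduction of `C₁⁻` in the DVR `𝔽̄₂⟦T₂⟧`.  Content in prose: Kriz 2016
Thm. 3 (CM congruence for every `χ ∈ Σ̂_cc`, hypothesis `p ∤ N`) read at `2` + the GL(1) two-variable main conjecture for `K`
at `2` restricted to the anticyclotomic line (JLK 2011, Oukhaba–Viguié 2016, Crişan–Müller 2020, Bullach–Hofer 2023) + control
/ no-pseudo-null bookkeeping for `X_Gr` at `2` (Greenberg 2016) + a Greenberg–Vatsal comparison at `2` (IDEA-NEEDED: at `2`,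
`E[2](K_v̄) ≠ 0`).  Vacuity-safe (stated for `C₁`, `red C₁ ≠ 0`). -/
def GreenbergAcLambdaLowerAt (W : WeierstrassCurve ℚ) [W.IsElliptic] [W.IsGloballyMinimal]
    (K : Type) [Field K] [NumberField K] : Prop :=
  ∀ [IsCMField K] (ι : PadicAlgCl 2 ≃+* ℂ) (v vbar : HeightOneSpectrum (𝓞 K)) (κ₁ κ₂ : ZpExtension K 2)
    (γ₁ γ₂ : absoluteGaloisGroup K) [Fact (ZpExtension.IsTopGeneratorPair κ₁ κ₂ γ₁ γ₂)]
    [NeZero (W.conductorNorm ℤ)] (f : CuspForm (Gamma0 (W.conductorNorm ℤ)) 2),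
    ModularForms.IsNewformOf W f → ∀ [NeZero (NumberField.discr K).natAbs],
    ((2 : ℕ) : 𝓞 K) ∈ v.asIdeal → ((2 : ℕ) : 𝓞 K) ∈ vbar.asIdeal → vbar ≠ v →
    (∀ (w : InfinitePlace K) (k : 𝓞 K), k ∈ v.asIdeal ↔ ‖ι.symm (w.embedding (k : K))‖ < 1) →
    κ₂.IsAnticyclotomic →
    ∀ (Ω δ : ℂ) (Ωp : (unrIntegers 2)ˣ) (LK G : A₂),
      Ω ≠ 0 → (δ ^ 2 = (NumberField.discr K : ℂ) ∨ δ ^ 2 = -(NumberField.discr K : ℂ)) →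
      IsKatzMeasure₂ ι v vbar ∅ κ₁ κ₂ γ₁⁻¹ γ₂⁻¹ 1 Ω δ ((Ωp : unrIntegers 2) : ℂ_[2]) LK →
      IsGreenbergLFunctionFree₂ ι v vbar κ₁ κ₂ γ₁⁻¹ γ₂⁻¹ f (NumberField.discr K).natAbs
        (NumberField.classNumber K) LK G →
      ∀ J : ℤ_[2] →+* PadicComplexInt 2,
        (∀ x : ℤ_[2], ((J x : PadicComplexInt 2) : ℂ_[2]) = ((x : ℚ_[2]) : ℂ_[2])) →
        ∀ C₀ : IwasawaAlgebra₂ 2,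
          WeierstrassCurve.XGr₂.charIdeal (W.baseChange K) 2 κ₁ κ₂ vbar γ₁ γ₂ = Ideal.span {C₀} →
          ∀ (a : ℕ) (C₁ : A₂), toUnr₂ 2 J C₀ = (2 : A₂) ^ a * C₁ → red₂ C₁ ≠ 0 →
            PowerSeries.map (IsLocalRing.residue (PadicComplexInt 2)) (minus G) ∣
              PowerSeries.map (IsLocalRing.residue (PadicComplexInt 2)) (minus C₁)

/-! ## §4. The pieces on the habitat (β) of O2 -/

/-- U on the habitat (β) (verbatim from the line of record). Research grade. -/
def TwoVariableUpperInclusionRatAtTwo : Prop :=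
  ∀ (W : WeierstrassCurve ℚ) [W.IsElliptic] [W.IsGloballyMinimal],
    ¬ W.HasCM → GoodOrd W 2 → ¬ W.HasIrreducibleModPGaloisRep 2 →
    ∀ (K : Type) [Field K] [NumberField K],
      (IsImaginaryQuadratic K ∧ SatisfiesHeegnerHypothesis (2 * W.conductorNorm ℤ) K) →
      GreenbergUpperInclusionRatAt W K

/-- R0T on the habitat (β) (verbatim from the line of record). Research grade. -/
def TwoVariableFrameTorsionAtTwo : Prop :=
  ∀ (W : WeierstrassCurve ℚ) [W.IsElliptic] [W.IsGloballyMinimal],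
    ¬ W.HasCM → GoodOrd W 2 → ¬ W.HasIrreducibleModPGaloisRep 2 →
    ∀ (K : Type) [Field K] [NumberField K],
      (IsImaginaryQuadratic K ∧ SatisfiesHeegnerHypothesis (2 * W.conductorNorm ℤ) K) →
      GreenbergFrameTorsionAt W K

/-- P0 on the habitat (verbatim from the line of record). Kernel algebra (PROVED, p766476). -/
def XGr₂CharIdealPrincipalAtTwo : Prop :=
  ∀ (W : WeierstrassCurve ℚ) [W.IsElliptic] [W.IsGloballyMinimal] (K : Type) [Field K] [NumberField K],
    XGr₂CharIdealPrincipalAt W K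

/-- Rres on the habitat (β) (verbatim from the line of record; comparison annex only). -/
def TwoVariableResidualEqualityForallAtTwo : Prop :=
  ∀ (W : WeierstrassCurve ℚ) [W.IsElliptic] [W.IsGloballyMinimal],
    ¬ W.HasCM → GoodOrd W 2 → ¬ W.HasIrreducibleModPGaloisRep 2 →
    ∀ (K : Type) [Field K] [NumberField K],
      (IsImaginaryQuadratic K ∧ SatisfiesHeegnerHypothesis (2 * W.conductorNorm ℤ) K) →
      GreenbergResidualEqualityForallAt W K

/-- **ACPIN on the habitat (β)** — the NEW research stub. -/
def AcFibrePinningAtTwo : Prop :=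
  ∀ (W : WeierstrassCurve ℚ) [W.IsElliptic] [W.IsGloballyMinimal],
    ¬ W.HasCM → GoodOrd W 2 → ¬ W.HasIrreducibleModPGaloisRep 2 →
    ∀ (K : Type) [Field K] [NumberField K],
      (IsImaginaryQuadratic K ∧ SatisfiesHeegnerHypothesis (2 * W.conductorNorm ℤ) K) →
      GreenbergAcFibrePinningAt W K

/-- ACPIN on anticyclotomic-adapted pairs, habitat (β). -/
def AcFibrePinningOnAcPairsAtTwo : Prop :=
  ∀ (W : WeierstrassCurve ℚ) [W.IsElliptic] [W.IsGloballyMinimal],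
    ¬ W.HasCM → GoodOrd W 2 → ¬ W.HasIrreducibleModPGaloisRep 2 →
    ∀ (K : Type) [Field K] [NumberField K],
      (IsImaginaryQuadratic K ∧ SatisfiesHeegnerHypothesis (2 * W.conductorNorm ℤ) K) →
      GreenbergAcFibrePinningOnAcPairsAt W K

/-- **N_ac on the habitat (β)**: `μ(G⁻) = 0` at `2`.  UNDECIDED / INSTRUMENTABLE. -/
def AcMuZeroAtTwo : Prop :=
  ∀ (W : WeierstrassCurve ℚ) [W.IsElliptic] [W.IsGloballyMinimal],
    ¬ W.HasCM → GoodOrd W 2 → ¬ W.HasIrreducibleModPGaloisRep 2 →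
    ∀ (K : Type) [Field K] [NumberField K],
      (IsImaginaryQuadratic K ∧ SatisfiesHeegnerHypothesis (2 * W.conductorNorm ℤ) K) →
      GreenbergAcMuZeroAt W K

/-- **Λ_ac on the habitat (β)**: the anticyclotomic `λ`-inequality at `2`.  UNDECIDED (leaves: Kriz-at-2 ATTACKABLE,
GL(1)-MC-at-2 ATTACKABLE-from-print, GV-at-2 IDEA-NEEDED). -/
def AcLambdaLowerAtTwo : Prop :=
  ∀ (W : WeierstrassCurve ℚ) [W.IsElliptic] [W.IsGloballyMinimal],
    ¬ W.HasCM → GoodOrd W 2 → ¬ W.HasIrreducibleModPGaloisRep 2 →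
    ∀ (K : Type) [Field K] [NumberField K],
      (IsImaginaryQuadratic K ∧ SatisfiesHeegnerHypothesis (2 * W.conductorNorm ℤ) K) →
      GreenbergAcLambdaLowerAt W K

/-! ## §5. Stubs (NOT registered — single-skeleton-slot ruling RC-555; names chosen so a lead can adopt them verbatim).
KERNEL (proved, no sorry): `stub_charIdealPrincipal` (P0), `stub_primePinning` (PIN), `stub_twoContent` (CONTENT).
RESEARCH (sorry): `stub_upperInclusionRat` (U, shared with the line of record), `stub_frameTorsion` (R0T, shared),
`stub_acFibrePinning` (ACPIN, NEW — replaces `stub_residualEquality`'s residual half Rres). -/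

/-- **stub P0** (kernel; proved by name from the accepted Theorems file, p766476). -/
theorem stub_charIdealPrincipal : XGr₂CharIdealPrincipalAtTwo :=
  fun W _ _ K _ _ vbar κ₁ κ₂ γ₁ γ₂ _ h =>
    Summit.BirchSwinnertonDyer.BirchSwinnertonDyer.Theorems.TwoAdicBDPCharIdealPrincipal.exists_xGr₂_charIdeal_eq_span_two
      W K vbar κ₁ κ₂ γ₁ γ₂ h

/-- **stub PIN** (kernel; proved in §1). -/
theorem stub_primePinning : PrimePinning₂ := primePinning₂_holds

/-- **stub CONTENT** (kernel; proved in §2). -/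
theorem stub_twoContent : TwoContent₂ := twoContent₂_holds

/-- **stub U** (research, XL; IDENTICAL statement to the line of record's `stub_upperInclusionRat`). -/
theorem stub_upperInclusionRat : TwoVariableUpperInclusionRatAtTwo := by
  sorry

/-- **stub R0T** (research; IDENTICAL statement to the object half `TwoVariableFrameTorsionAtTwo` of the line of record's
`stub_residualEquality`: existence of an admissible frame datum at `2` — `LK` in print (de Shalit II.4.12/4.14), the
two-variable `G` at `2` unprinted — and `Λ_K`-torsion of `X_Gr`). -/
theorem stub_frameTorsion : TwoVariableFrameTorsionAtTwo := by
  sorry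

/-- **stub ACPIN** (research, NEW): anticyclotomic special-fibre pinning on habitat (β) — see `GreenbergAcFibrePinningAt`.
WEAKER than the line of record's Rres (`acFibrePinningAtTwo_of_residualEqualityForallAtTwo`, §7). -/
theorem stub_acFibrePinning : AcFibrePinningAtTwo := by
  sorry

/-! ## §6. Composition — concludes the crux BY NAME -/

/-- **THE NODE** `O2 ⟸ P0 ∧ PIN ∧ CONTENT ∧ U ∧ R0T ∧ ACPIN`, sorry-free (logic + `Ideal` algebra over the tree's
definitions).  Given the frame from R0T, a generator `C₀` from P0, the slack `2^m G ∈ (J C₀)` from U, the content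
decomposition `J C₀ = 2^a C₁` from CONTENT and the prime `𝔓` from ACPIN, PIN pins the cofactor: `(J C₀) ⊆ (G)`. -/
theorem bdpSelmerLowerDivisibilityAtTwo_of_acPieces :
    XGr₂CharIdealPrincipalAtTwo → PrimePinning₂ → TwoContent₂ → TwoVariableUpperInclusionRatAtTwo →
      TwoVariableFrameTorsionAtTwo → AcFibrePinningAtTwo → BDPSelmerLowerDivisibilityAtTwo := by
  intro hP hPin hCt hU h0 hA W _ _ hCM hGO hβ K _ _ hK _ ι v vbar κ₁ κ₂ γ₁ γ₂ _ _ f hf _ hv hvbar hne hι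
  obtain ⟨Ω, δ, Ωp, LK, G, hΩ, hδ, hLK, hG, htor⟩ :=
    h0 W hCM hGO hβ K hK ι v vbar κ₁ κ₂ γ₁ γ₂ f hf hv hvbar hne hι
  refine ⟨Ω, δ, Ωp, LK, G, hΩ, hδ, hLK, hG, htor, fun J hJ => ?_⟩
  obtain ⟨C₀, hC₀⟩ := hP W K vbar κ₁ κ₂ γ₁ γ₂ htor
  obtain ⟨m, hm⟩ := hU W hCM hGO hβ K hK ι v vbar κ₁ κ₂ γ₁ γ₂ f hf hv hvbar hne hι Ω δ Ωp LK G hΩ hδ hLK hG J hJ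
  obtain ⟨𝔓, h𝔓, hN, hΛ⟩ :=
    hA W hCM hGO hβ K hK ι v vbar κ₁ κ₂ γ₁ γ₂ f hf hv hvbar hne hι Ω δ Ωp LK G hΩ hδ hLK hG J hJ C₀ hC₀
  rw [hC₀, Ideal.map_span, Set.image_singleton] at hm ⊢
  obtain ⟨h, hh⟩ := Ideal.mem_span_singleton'.mp (hm (Ideal.mem_span_singleton_self _))
  by_cases hC00 : C₀ = 0
  · rw [hC00, map_zero, Ideal.span_singleton_eq_bot.mpr rfl]
    exact bot_le
  · obtain ⟨a, C₁, haC₁, hC₁⟩ := hCt J C₀ hC00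
    rw [haC₁] at hh ⊢
    exact hPin C₁ G h a m 𝔓 h𝔓 (by rw [← hh]; ring) hC₁ hN (hΛ a C₁ haC₁ hC₁)

/-- **The crux BY NAME** from the six stubs by name (sorries inherited: exactly U, R0T, ACPIN). -/
theorem BDPSelmerLowerDivisibilityAtTwo_of : BDPSelmerLowerDivisibilityAtTwo :=
  bdpSelmerLowerDivisibilityAtTwo_of_acPieces stub_charIdealPrincipal stub_primePinning stub_twoContent
    stub_upperInclusionRat stub_frameTorsion stub_acFibrePinning

/-! ## §7. Comparison annex (sorry-free): ACPIN is WEAKER than Rres; N_ac ∧ Λ_ac give ACPIN on anticyclotomic pairs -/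

/-- Rres ⇒ ACPIN at a datum (`𝔓 = ⊥`). -/
theorem greenbergAcFibrePinningAt_of_residualEqualityForall (W : WeierstrassCurve ℚ) [W.IsElliptic]
    [W.IsGloballyMinimal] (K : Type) [Field K] [NumberField K]
    (hres : GreenbergResidualEqualityForallAt W K) : GreenbergAcFibrePinningAt W K := by
  intro _ ι v vbar κ₁ κ₂ γ₁ γ₂ _ _ f hf _ hv hvbar hne hι Ω δ Ωp LK G hΩ hδ hLK hG J hJ C₀ hC₀
  obtain ⟨hC0, hspan⟩ := hres ι v vbar κ₁ κ₂ γ₁ γ₂ f hf hv hvbar hne hι Ω δ Ωp LK G hΩ hδ hLK hG J hJ C₀ hC₀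
  exact fibrePinned_of_residualEquality G _ hC0 hspan

/-- **Rres ⇒ ACPIN on the habitat**: the new research stub is implied by the line of record's residual stub. -/
theorem acFibrePinningAtTwo_of_residualEqualityForallAtTwo :
    TwoVariableResidualEqualityForallAtTwo → AcFibrePinningAtTwo :=
  fun h W _ _ hCM hGO hβ K _ _ hK =>
    greenbergAcFibrePinningAt_of_residualEqualityForall W K (h W hCM hGO hβ K hK)

/-- ACPIN ⇒ ACPIN on anticyclotomic pairs (drop the hypothesis). -/
theorem greenbergAcFibrePinningOnAcPairsAt_of_acFibrePinningAt (W : WeierstrassCurve ℚ) [W.IsElliptic]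
    [W.IsGloballyMinimal] (K : Type) [Field K] [NumberField K]
    (h : GreenbergAcFibrePinningAt W K) : GreenbergAcFibrePinningOnAcPairsAt W K := by
  intro _ ι v vbar κ₁ κ₂ γ₁ γ₂ _ _ f hf _ hv hvbar hne hι _ Ω δ Ωp LK G hΩ hδ hLK hG J hJ C₀ hC₀
  exact h ι v vbar κ₁ κ₂ γ₁ γ₂ f hf hv hvbar hne hι Ω δ Ωp LK G hΩ hδ hLK hG J hJ C₀ hC₀

/-- **N_ac ∧ Λ_ac ⇒ ACPIN on anticyclotomic pairs** (`𝔓 = (T₁)`, `fibrePinned_of_minus`): the coordinate shadows are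
genuinely the content of the new stub on `(κ₁, κ_ac)`-adapted pairs. -/
theorem greenbergAcFibrePinningOnAcPairsAt_of_coord (W : WeierstrassCurve ℚ) [W.IsElliptic]
    [W.IsGloballyMinimal] (K : Type) [Field K] [NumberField K]
    (hN : GreenbergAcMuZeroAt W K) (hΛ : GreenbergAcLambdaLowerAt W K) :
    GreenbergAcFibrePinningOnAcPairsAt W K := by
  intro _ ι v vbar κ₁ κ₂ γ₁ γ₂ _ _ f hf _ hv hvbar hne hι hac Ω δ Ωp LK G hΩ hδ hLK hG J hJ C₀ hC₀
  exact fibrePinned_of_minus G _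
    (hN ι v vbar κ₁ κ₂ γ₁ γ₂ f hf hv hvbar hne hι hac Ω δ Ωp LK G hΩ hδ hLK hG)
    (fun a C₁ haC₁ hC₁ => hΛ ι v vbar κ₁ κ₂ γ₁ γ₂ f hf hv hvbar hne hι hac Ω δ Ωp LK G hΩ hδ hLK hG J hJ C₀ hC₀ a C₁ haC₁ hC₁)

/-- Habitat form of the previous theorem. -/
theorem acFibrePinningOnAcPairsAtTwo_of_coord :
    AcMuZeroAtTwo → AcLambdaLowerAtTwo → AcFibrePinningOnAcPairsAtTwo :=
  fun hN hΛ W _ _ hCM hGO hβ K _ _ hK =>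
    greenbergAcFibrePinningOnAcPairsAt_of_coord W K (hN W hCM hGO hβ K hK) (hΛ W hCM hGO hβ K hK)

/-- **STRENGTH CERTIFICATE (honesty, typed)**: the body of ACPIN FOLLOWS from O2's own conclusion `(C') ⊆ (G)` together
with the two-variable analytic `μ = 0` (`red G ≠ 0`) — with NO upper inclusion.  So, modulo U and CONTENT, ACPIN at a frame
datum is EQUIVALENT to «O2's inclusion ∧ `μ(G) = 0`»: the node does not weaken O2, it RELOCATES its research content to
(N) + (Λ) along one prime of the special fibre and drops the algebraic `μ = 0` of `Rres`.  (`𝔓 = ⊥` witnesses it.) [folklore] -/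
theorem fibrePinned_of_span_le (G C' : A₂) (hG : red₂ G ≠ 0) (hle : Ideal.span {C'} ≤ Ideal.span {G}) :
    FibrePinned G C' := by
  refine ⟨⊥, Ideal.isPrime_bot, ?_, fun a C₁ haC₁ _ => ?_⟩
  · rw [Ideal.mem_bot]; exact hG
  · obtain ⟨h, hh⟩ := Ideal.mem_span_singleton'.mp (hle (Ideal.mem_span_singleton_self C'))
    have hGu : ∃ i : ℕ × ℕ, IsUnit (coeff i.2 (coeff i.1 G)) := exists_isUnit_coeff_of_map_map_residue_ne_zero hG
    have hdvd : PowerSeries.C (PowerSeries.C ((2 : PadicComplexInt 2) ^ a)) ∣ G * h :=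
      ⟨C₁, by rw [mul_comm G h, hh, haC₁, two_pow_eq_C_C]⟩
    obtain ⟨h₀, rfl⟩ := C_C_dvd_of_C_C_dvd_mul_of_exists_isUnit_coeff hGu hdvd
    have hC₁ : C₁ = G * h₀ := by
      refine mul_left_cancel₀ (two_pow_ne_zero_A₂ a) ?_
      rw [← haC₁, ← hh, two_pow_eq_C_C]; ring
    rw [bot_sup_eq]
    exact Ideal.mem_span_singleton'.mpr ⟨red₂ h₀, by rw [hC₁, map_mul, mul_comm]⟩

end Summit.BirchSwinnertonDyer.BirchSwinnertonDyer.Cruxes.BDPSelmerLowerDivisibilityAtTwo.AnticyclotomicFibrePinningTwo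

end
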